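import Summits.BirchSwinnertonDyer.Rank1Residual.X9.PrintCertClaim
import Summits.BirchSwinnertonDyer.Rank1Residual.X9.PrintCertRecordsS4R1A
import Summits.BirchSwinnertonDyer.Rank1Residual.X9.PrintCertRecordsS4R1B
import Summits.BirchSwinnertonDyer.Rank1Residual.X9.PrintCertRecordsS4R1C
import Summits.BirchSwinnertonDyer.Rank1Residual.X9.PrintCertRecordsS4R1D
import HarnessLib

/-!
# Leaf X9, image `5S4`, analytic rank `1` — certificate records: the in-kernel RECHECK of the display files (327 records)

HONEST FRAMING (cell `bsd-print-x9`, D-0131 (2) print tier): theorems only, all by `decide +kernel` on literal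
data. `certified_<slice> : Certified records<slice>` — the kernel re-runs `Record.check` (`X9/PrintCertSchema.lean`:
recomputed `Δ`, `c₄`, exact valuations and reduction types at the listed primes with `|Δ| = ∏ q^v`, Tate's `c_q`
shape, the point counts `a_p` / `a_ℓ`, the irreducibility witness, non-CM, Zywina's `j`-identity for the image
certificate, the leaf clauses, the BSD identity `x0·#tors² = #Ш_an·∏c_q`, and the coherence of the two-engine
`λ_an` with `x0` and `a_p`) on every record of `X9/PrintCertRecords<slice>.lean`; `krausCheck_<slice>` — Kraus'
minimality certificate `Record.krausCheck` (`X9/PrintCertClaim.lean`) passes for every listed model except the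
displayed a-invariant lists (3 of 327: models outside Kraus' `2`-adic clauses, minimal by Cremona/PARI),
so `Record.isGloballyMinimal_curve_of_krausCheck` makes `r.curve` globally minimal in the kernel for 324/327;
`imageCert_<slice>` — every record carries Zywina's parameter (`¬Surj` in the kernel modulo the `j`-line facts,
`Record.not_surj_of_check` in `X9/PrintCertImage.lean`).
Nothing about any curve is asserted beyond these decidable identities; nothing is booked; no leaf is closed
(`BSDpOnClassX9` / `BSDpOnClassX10b` stay `@[conjecture]`). What a certified record then GIVES is
`X9/PrintCertBridge.lean` (kernel: good ordinary, `a_p`, irreducible, non-CM, (ram)/semistability, `ClassX9` /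
`ClassX10` up to the claims) and `X9/PrintCertClaim.lean` (claims `¬Surj`, `r_an`, BSD data, `λ_an`/`μ_an`).
-/

namespace Summit.BirchSwinnertonDyer.Rank1Residual.X9.PrintCert

/-- In-kernel recheck of the 82 records `recordsS4R1A` (conductors `648`–`35344`): every record passes
`Record.check`. [folklore] -/
theorem certified_S4R1A : Certified recordsS4R1A := by
  decide +kernel

/-- Every record of `recordsS4R1A` carries an image certificate (Zywina parameter `t = u/v` with the
`j`-identity rechecked), so `Record.not_surj_of_check` (`X9/PrintCertImage.lean`) applies. [folklore] -/
theorem imageCert_S4R1A : ∀ r ∈ recordsS4R1A, r.imageCert.isSome = true := by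
  decide +kernel

/-- Kraus' minimality certificate passes for every record of `recordsS4R1A` except the 2 displayed
model(s) (a-invariants; outside Kraus' `2`-adic clauses). [cite: Kraus1989, Prop. 1 and Prop. 2] -/
theorem krausCheck_S4R1A : ∀ r ∈ recordsS4R1A, r.krausCheck = true ∨
    r.ainvs ∈ [[0, 0, 0, -3841451, 2937567962], [0, 0, 0, -1739, -28294]] := by
  decide +kernel

/-- In-kernel recheck of the 82 records `recordsS4R1B` (conductors `36288`–`138384`): every record passes
`Record.check`. [folklore] -/
theorem certified_S4R1B : Certified recordsS4R1B := by
  decide +kernel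

/-- Every record of `recordsS4R1B` carries an image certificate (Zywina parameter `t = u/v` with the
`j`-identity rechecked), so `Record.not_surj_of_check` (`X9/PrintCertImage.lean`) applies. [folklore] -/
theorem imageCert_S4R1B : ∀ r ∈ recordsS4R1B, r.imageCert.isSome = true := by
  decide +kernel

/-- Kraus' minimality certificate passes for every record of `recordsS4R1B`. [cite: Kraus1989, Prop. 1 and Prop. 2] -/
theorem krausCheck_S4R1B : ∀ r ∈ recordsS4R1B, r.krausCheck = true := by
  decide +kernel

/-- In-kernel recheck of the 82 records `recordsS4R1C` (conductors `138384`–`254016`): every record passes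
`Record.check`. [folklore] -/
theorem certified_S4R1C : Certified recordsS4R1C := by
  decide +kernel

/-- Every record of `recordsS4R1C` carries an image certificate (Zywina parameter `t = u/v` with the
`j`-identity rechecked), so `Record.not_surj_of_check` (`X9/PrintCertImage.lean`) applies. [folklore] -/
theorem imageCert_S4R1C : ∀ r ∈ recordsS4R1C, r.imageCert.isSome = true := by
  decide +kernel

/-- Kraus' minimality certificate passes for every record of `recordsS4R1C`. [cite: Kraus1989, Prop. 1 and Prop. 2] -/
theorem krausCheck_S4R1C : ∀ r ∈ recordsS4R1C, r.krausCheck = true := by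
  decide +kernel

/-- In-kernel recheck of the 81 records `recordsS4R1D` (conductors `254016`–`496008`): every record passes
`Record.check`. [folklore] -/
theorem certified_S4R1D : Certified recordsS4R1D := by
  decide +kernel

/-- Every record of `recordsS4R1D` carries an image certificate (Zywina parameter `t = u/v` with the
`j`-identity rechecked), so `Record.not_surj_of_check` (`X9/PrintCertImage.lean`) applies. [folklore] -/
theorem imageCert_S4R1D : ∀ r ∈ recordsS4R1D, r.imageCert.isSome = true := by
  decide +kernel

/-- Kraus' minimality certificate passes for every record of `recordsS4R1D` except the 1 displayed
model(s) (a-invariants; outside Kraus' `2`-adic clauses). [cite: Kraus1989, Prop. 1 and Prop. 2] -/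
theorem krausCheck_S4R1D : ∀ r ∈ recordsS4R1D, r.krausCheck = true ∨
    r.ainvs ∈ [[0, 0, 0, -139, -2502]] := by
  decide +kernel

end Summit.BirchSwinnertonDyer.Rank1Residual.X9.PrintCert
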